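import Summits.ValiantsHypothesis.ValiantsHypothesis.Theorems.BarrierLeverChowBenchmarkPairsBlockPeelConcat
import Summits.ValiantsHypothesis.ValiantsHypothesis.Theorems.BarrierLeverChowBenchmarkPairsBlockPeelLadder

/-!
# Route BarrierLever — item 22038 `ChowBenchmarkPairs`, line `moore-peel`: the BLOCK PEEL, VI — blocks over GOOD
# stages of THEOREM W are good (decidable instances), and CONJECTURE B3 away from the bad stages up to `5000`

Helper file (`--supports stmt-ValiantsHypothesis-22038`; cell valiant-natproofs, rung V4, 𝒟-side benchmark of
record, line `moore_peel`, planner SUCCESSOR MANDATE M1 (HOME/STATUS.md l.1824); seat val-np-p4 gen 30).  Closes NO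
item; definition-free.  Companion of `…BlockPeelConcat` (p715288: good blocks are closed under concatenation).

* `det_blockMatrix_factorial_X_ne_zero_of_good`: a block `J^{!}(i,t)` all of whose stages `i, …, i+t-1` are GOOD
  stages of the one-point segment peel (`det G_j ≠ 0`) is good — by `det_blockMatrix_X_ne_zero_of_cuts` with singles;
  `det_blockMatrix_factorial_X_ne_zero_of_badStageFast` — the same from THEOREM W's DECIDABLE predicate
  `badStageFast j = false` (`…DirichletTables`), so every concrete instance is one `decide`;
  `conjB3_instance_of_badStageFast` (the triple case).
* `det_peelMatrix_ne_zero_of_not_mem_of_le_5000` / `conjB3_instance_of_not_near_table`: with THEOREM W's kernel table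
  `badStagesLe5000` (the 41 bad stages `≤ 5000`), `det J^{!}(i,3) ≠ 0` for every `1 ≤ i ≤ 4998` such that none of
  `i, i+1, i+2` is in the table — CONJECTURE B3 below `5000` is thereby reduced, in the kernel, to the (at most
  `3 · 41`) triples touching the table, all of which are numerically nonsingular (kit j323569 / j324405, memo g28 §3.1;
  not kernel-checked: the smallest, `{181,182,183}`, is a `549 × 549` symbolic determinant);
  `conjB3_instance_of_ge_184_le_361`: the kernel range `184 ≤ i ≤ 361` in closed form (the only bad stage `< 364` is
  `183`, `bad_le_363`).

WHAT THIS IS NOT: `Stmt.conjB3` (∀ i) and node #1 (∀ h) stay OPEN; the triples touching a bad stage are NOT certified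
here (numerical only; `i ∈ {181, 182}` follow in the computational lane from `det_blockMatrix_182_2_ne_zero`); nothing on
crux stmt-ValiantsHypothesis-14610 or on `VP` versus `VNP`.
-/

set_option linter.dupNamespace false

namespace Summit.ValiantsHypothesis.ValiantsHypothesis.Theorems.BarrierLever.MoorePeel

open Polynomial Finset

/-! ## 16. Blocks over good stages -/

/-- **A block over good stages is good**: if `det G_{i+q} ≠ 0` for every `q < t` (`1 ≤ i`) then
`det J^{!}(i,t)(Λ) ≠ 0` in `ℤ[Λ]` (the all-singles tiling, concatenated). -/
theorem det_blockMatrix_factorial_X_ne_zero_of_good (i t : ℕ) (hi : 1 ≤ i)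
    (hgood : ∀ q, q < t → (peelMatrix (i + q)).det ≠ 0) :
    (blockMatrix Nat.factorial i t (fun s : Fin t => (MvPolynomial.X s : MvPolynomial (Fin t) ℤ))).det ≠ 0 := by
  have key := det_blockMatrix_X_ne_zero_of_cuts Nat.factorial (fun k => Nat.factorial_ne_zero k) t
    (fun q => i + q) (by omega) (fun q _ => by omega)
    (fun q hq => by
      have e : i + (q + 1) - (i + q) = 1 := by omega
      refine det_blockMatrix_X_ne_zero_of_eq Nat.factorial (i + q) e ?_
      rw [det_blockMatrix_one_X_ne_zero_iff, kpeelMatrix_factorial]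
      exact hgood q hq)
  have e : i + t - (i + 0) = t := by omega
  rw [e, Nat.add_zero] at key
  exact key

/-- The same from THEOREM W's decidable bad-stage predicate: `badStageFast (i+q) = false` for `q < t`. -/
theorem det_blockMatrix_factorial_X_ne_zero_of_badStageFast (i t : ℕ) (hi : 1 ≤ i)
    (hgood : ∀ q, q < t → badStageFast (i + q) = false) :
    (blockMatrix Nat.factorial i t (fun s : Fin t => (MvPolynomial.X s : MvPolynomial (Fin t) ℤ))).det ≠ 0 := by
  refine det_blockMatrix_factorial_X_ne_zero_of_good i t hi fun q hq h0 => ?_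
  rw [det_peelMatrix_eq_zero_iff_badStageFast, hgood q hq] at h0
  exact Bool.false_ne_true h0

/-- **A CONJECTURE-B3 instance from three good stages, decidably**: `badStageFast j = false` for `j = i, i+1, i+2`
gives `det J^{!}(i,3)(Λ) ≠ 0` (any concrete `i`: three `decide`s). -/
theorem conjB3_instance_of_badStageFast (i : ℕ) (hi : 1 ≤ i) (h0 : badStageFast i = false)
    (h1 : badStageFast (i + 1) = false) (h2 : badStageFast (i + 2) = false) :
    (blockMatrix Nat.factorial i 3 (fun s : Fin 3 => (MvPolynomial.X s : MvPolynomial (Fin 3) ℤ))).det ≠ 0 := by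
  refine det_blockMatrix_factorial_X_ne_zero_of_badStageFast i 3 hi fun q hq => ?_
  interval_cases q
  · simpa using h0
  · exact h1
  · exact h2

/-! ## 17. CONJECTURE B3 below `5000` away from THEOREM W's table -/

/-- Good stages from the table: for `1 ≤ j ≤ 5000` not among the 41 listed bad stages, `det G_j ≠ 0`. -/
theorem det_peelMatrix_ne_zero_of_not_mem_of_le_5000 (j : ℕ) (h1 : 1 ≤ j) (hj : j ≤ 5000)
    (hnot : j ∉ badStagesLe5000) : (peelMatrix j).det ≠ 0 := fun h0 =>
  hnot ((det_peelMatrix_eq_zero_iff_mem_of_le_5000 j h1 hj).mp h0)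

/-- **Blocks away from the table are good**: `1 ≤ i`, `i + t ≤ 5001`, no stage of `[i, i+t)` in `badStagesLe5000`
⇒ `det J^{!}(i,t)(Λ) ≠ 0`. -/
theorem det_blockMatrix_factorial_X_ne_zero_of_not_mem_table (i t : ℕ) (hi : 1 ≤ i) (hit : i + t ≤ 5001)
    (hnot : ∀ q, q < t → i + q ∉ badStagesLe5000) :
    (blockMatrix Nat.factorial i t (fun s : Fin t => (MvPolynomial.X s : MvPolynomial (Fin t) ℤ))).det ≠ 0 :=
  det_blockMatrix_factorial_X_ne_zero_of_good i t hi fun q hq =>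
    det_peelMatrix_ne_zero_of_not_mem_of_le_5000 (i + q) (by omega) (by omega) (hnot q hq)

/-- **CONJECTURE B3 below `5000`, away from the table**: for `1 ≤ i ≤ 4998` with none of `i, i+1, i+2` among the
41 bad stages of THEOREM W, `det J^{!}(i,3)(Λ) ≠ 0` — so B3 below `5000` lives on the (at most `123`) triples touching
the table. -/
theorem conjB3_instance_of_not_near_table (i : ℕ) (hi : 1 ≤ i) (hi' : i ≤ 4998)
    (hfar : ∀ b ∈ badStagesLe5000, b ≠ i ∧ b ≠ i + 1 ∧ b ≠ i + 2) :
    (blockMatrix Nat.factorial i 3 (fun s : Fin 3 => (MvPolynomial.X s : MvPolynomial (Fin 3) ℤ))).det ≠ 0 := by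
  refine det_blockMatrix_factorial_X_ne_zero_of_not_mem_table i 3 hi (by omega) fun q hq hmem => ?_
  obtain ⟨hb0, hb1, hb2⟩ := hfar (i + q) hmem
  interval_cases q <;> simp_all

/-- **The kernel range `184 ≤ i ≤ 361` in closed form**: the only bad stage below `364` is `183` (`bad_le_363`),
so every triple inside `[184, 364)` is good. -/
theorem conjB3_instance_of_ge_184_le_361 (i : ℕ) (hi : 184 ≤ i) (hi' : i ≤ 361) :
    (blockMatrix Nat.factorial i 3 (fun s : Fin 3 => (MvPolynomial.X s : MvPolynomial (Fin 3) ℤ))).det ≠ 0 := by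
  refine det_blockMatrix_factorial_X_ne_zero_of_not_mem_table i 3 (by omega) (by omega) fun q hq hmem => ?_
  have := bad_le_363 (i + q) (List.mem_range.mpr (by omega)) hmem
  omega

/-- Every block inside `[184, 364)` is good (singles `184, …, 363` are good by the table). -/
theorem det_blockMatrix_factorial_X_ne_zero_of_ge_184_le_364 (i t : ℕ) (hi : 184 ≤ i) (hit : i + t ≤ 364) :
    (blockMatrix Nat.factorial i t (fun s : Fin t => (MvPolynomial.X s : MvPolynomial (Fin t) ℤ))).det ≠ 0 := by
  refine det_blockMatrix_factorial_X_ne_zero_of_not_mem_table i t (by omega) (by omega) fun q hq hmem => ?_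
  have := bad_le_363 (i + q) (List.mem_range.mpr (by omega)) hmem
  omega

end Summit.ValiantsHypothesis.ValiantsHypothesis.Theorems.BarrierLever.MoorePeel
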